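import Summits.CriticalPhenomena.PercolationContinuityZ3.Theorems.Transplant.SharpnessRayGraph
import Summits.CriticalPhenomena.PercolationContinuityZ3.Theorems.Transplant.SharpnessRayScales
import Literature.Probability.Percolation.HarrisTheorem
import Literature.Probability.Percolation.FiniteEnergy
import HarnessLib

/-!
# Transplant sharpness LXII — the multi-scale assembly for the reinforced ray: blocked annuli of the effective
# configuration at the scales `4^{k+1}` kill percolation, given a `c/(A + kB)` lower bound per scale

builds on p205010 (kernel theorem, internal audit signed; external expert review pending).
Status sentence (coordinator 2026-08-20T04:30Z): "θ(p_c) = 0 on ℤ^d, all d ≥ 2 — kernel-verified (Lean 4/Mathlib,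
standard axioms); internal adversarial audit SIGNED 2026-08-20 04:29Z; external expert review pending."

Lane `prim-bschramm`, seat p5 (sharpness); memo `run/shared/lean/prim/bschramm/P5-SHARPNESS.md` §48, row 85 (kernel
programme "RAY"; plan `run/shared/lean/prim/bschramm/prim-bschramm-p5-g22/RAY-PLAN.md` §5).

Harris' square-annulus scheme (`Literature.Probability.Percolation.HarrisTheorem`: `annulusBlocked n`,
`not_mem_percolatesAt_of_annulusBlocked`, `determinedBy_annulusBlocked`, `real_iInter_compl_annulusBlocked`)
transported to `G_ray` through the effective configuration of LXI:

* `liftPairs F` (local notation) — the edges of `G_ray` over a set `F` of lattice pairs: the lattice copies, and the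
  two detour edges of every ray edge in `F`; `determinedBy_preimage_effConfig` — an event of the effective configuration
  determined by `F` is, as an event of `ω`, determined by `liftPairs F`; `disjoint_liftPairs`;
* `real_iInter_compl_block` — the product formula `P(⋂_{k<K} {effConfig ∉ annulusBlocked 4^{k+1}}) =
  ∏_{k<K} (1 − P(effConfig ∈ annulusBlocked 4^{k+1}))` (any `p`);
* `theta_rayGraph_eq_zero_of_blockLower` — **if `P_p(effConfig ω ∈ annulusBlocked 4^{k+1}) ≥ c/(A + kB)` for all
  `k ≥ k₀` (`c, A, B > 0`) then `θ_{G_ray}(inl 0, p) = 0`**: `θ ≤ ∏ (1 − c/(A+kB)) ≤ exp(−Σ c/(A+kB)) → 0`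
  (`Ray.tendsto_sum_div_affine_atTop`, LV).

The hypothesis is the matching lower bound of RAY-PLAN §3 at `p = 1/2` (modules LXIII–LXIV).
-/

noncomputable section

namespace Summit.CriticalPhenomena.PercolationContinuityZ3.Theorems.TransplantSharpness

namespace Ray

open Literature.Probability.Percolation Literature.Probability.LatticeModels
open MeasureTheory Filter Set SimpleGraph
open scoped Topology

/-- The edges of `G_ray` lying over a set `F` of lattice pairs. -/
local notation3 "liftPairs[" F "]" => {E : Sym2 (Site 2 ⊕ ℕ) |
  (∃ e ∈ (F : Set (Sym2 (Site 2))), E = e.map Sum.inl) ∨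
  ∃ k : ℕ, rayEdge k ∈ (F : Set (Sym2 (Site 2))) ∧
    (E = s(Sum.inl (rayPt k false), Sum.inr k) ∨ E = s(Sum.inr k, Sum.inl (rayPt k true)))}
local notation3 "μ[" p "]" => bondPercolation rayGraph p
/-- The effective configuration has a blocked annulus at scale `n`. -/
local notation3 "block[" n "]" => effConfig ⁻¹' annulusBlocked n

/-! ### Locality of events of the effective configuration -/

/-- Two configurations of `G_ray` agreeing on `liftPairs F` have effective configurations agreeing on `F`. [folklore] -/
theorem effConfig_inter_eq {F : Set (Sym2 (Site 2))} {ω ω' : BondConfig (Site 2 ⊕ ℕ)}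
    (h : ω ∩ liftPairs[F] = ω' ∩ liftPairs[F]) : effConfig ω ∩ F = effConfig ω' ∩ F := by
  have key : ∀ E ∈ liftPairs[F], E ∈ ω ↔ E ∈ ω' := by
    intro E hE
    constructor
    · intro hEω; have : E ∈ ω ∩ liftPairs[F] := ⟨hEω, hE⟩; rw [h] at this; exact this.1
    · intro hEω; have : E ∈ ω' ∩ liftPairs[F] := ⟨hEω, hE⟩; rw [← h] at this; exact this.1
  have keff : ∀ ω₁ ω₂ : BondConfig (Site 2 ⊕ ℕ), (∀ E ∈ liftPairs[F], E ∈ ω₁ ↔ E ∈ ω₂) →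
      ∀ e ∈ F, e ∈ effConfig ω₁ → e ∈ effConfig ω₂ := by
    intro ω₁ ω₂ hk e heF he
    rcases he with he | ⟨k, rfl, h1, h2⟩
    · exact Or.inl ((hk _ (Or.inl ⟨e, heF, rfl⟩)).1 he)
    · refine Or.inr ⟨k, rfl, ?_, ?_⟩
      · exact (hk _ (Or.inr ⟨k, heF, Or.inl rfl⟩)).1 h1
      · exact (hk _ (Or.inr ⟨k, heF, Or.inr rfl⟩)).1 h2
  ext e
  constructor
  · rintro ⟨he, heF⟩; exact ⟨keff ω ω' key e heF he, heF⟩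
  · rintro ⟨he, heF⟩; exact ⟨keff ω' ω (fun E hE => (key E hE).symm) e heF he, heF⟩

/-- **Locality**: if a lattice event `B` is determined by the pairs `F`, the event `{effConfig ω ∈ B}` is determined by
the edges of `G_ray` over `F`. [folklore] -/
theorem determinedBy_preimage_effConfig {B : Set (BondConfig (Site 2))} {F : Set (Sym2 (Site 2))}
    (hB : DeterminedBy B F) : DeterminedBy (effConfig ⁻¹' B) liftPairs[F] := by
  rw [determinedBy_iff] at hB ⊢
  intro ω ω' h
  simp only [Set.mem_preimage]
  exact hB _ _ (effConfig_inter_eq h)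

/-- The ray edge determines its index. [folklore] -/
theorem rayEdge_injective : Function.Injective rayEdge := by
  intro k l h
  rw [rayEdge, rayEdge, Sym2.eq_iff] at h
  rcases h with ⟨h1, -⟩ | ⟨h1, h2⟩
  · have := congrFun h1 0; simp [rayPt] at this; omega
  · have e1 := congrFun h1 0; have e2 := congrFun h2 0; simp [rayPt] at e1 e2; omega

/-- **Disjointness**: disjoint sets of lattice pairs lift to disjoint sets of edges of `G_ray`. [folklore] -/
theorem disjoint_liftPairs {F F' : Set (Sym2 (Site 2))} (h : Disjoint F F') : Disjoint liftPairs[F] liftPairs[F'] := by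
  rw [Set.disjoint_left] at h ⊢
  rintro E hE hE'
  rcases hE with ⟨e, he, rfl⟩ | ⟨k, hk, hEk⟩ <;> rcases hE' with ⟨e', he', hee'⟩ | ⟨k', hk', hEk'⟩
  · have : e = e' := Sym2.map.injective Sum.inl_injective hee'
    exact h he (this ▸ he')
  · -- a lattice copy is never a detour edge
    rcases hEk' with hq | hq
    · have hmem : (Sum.inr k' : Site 2 ⊕ ℕ) ∈ Sym2.map Sum.inl e := by rw [hq]; exact Sym2.mem_mk_right _ _
      rw [Sym2.mem_map] at hmem; obtain ⟨a, -, ha⟩ := hmem; exact Sum.inl_ne_inr ha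
    · have hmem : (Sum.inr k' : Site 2 ⊕ ℕ) ∈ Sym2.map Sum.inl e := by rw [hq]; exact Sym2.mem_mk_left _ _
      rw [Sym2.mem_map] at hmem; obtain ⟨a, -, ha⟩ := hmem; exact Sum.inl_ne_inr ha
  · rcases hEk with rfl | rfl
    · have hmem : (Sum.inr k : Site 2 ⊕ ℕ) ∈ Sym2.map Sum.inl e' := by rw [← hee']; exact Sym2.mem_mk_right _ _
      rw [Sym2.mem_map] at hmem; obtain ⟨a, -, ha⟩ := hmem; exact Sum.inl_ne_inr ha
    · have hmem : (Sum.inr k : Site 2 ⊕ ℕ) ∈ Sym2.map Sum.inl e' := by rw [← hee']; exact Sym2.mem_mk_left _ _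
      rw [Sym2.mem_map] at hmem; obtain ⟨a, -, ha⟩ := hmem; exact Sum.inl_ne_inr ha
  · -- two detour edges: same index
    have hkk : k = k' := by
      have aux : ∀ E : Sym2 (Site 2 ⊕ ℕ), (E = s(Sum.inl (rayPt k false), Sum.inr k) ∨
          E = s(Sum.inr k, Sum.inl (rayPt k true))) → (Sum.inr k : Site 2 ⊕ ℕ) ∈ E := by
        rintro E (rfl | rfl)
        · exact Sym2.mem_mk_right _ _
        · exact Sym2.mem_mk_left _ _
      have h1 := aux E hEk
      rcases hEk' with rfl | rfl
      · rw [Sym2.mem_iff] at h1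
        rcases h1 with h1 | h1
        · exact absurd h1.symm Sum.inl_ne_inr
        · exact Sum.inr_injective h1
      · rw [Sym2.mem_iff] at h1
        rcases h1 with h1 | h1
        · exact Sum.inr_injective h1
        · exact absurd h1.symm Sum.inl_ne_inr
    subst hkk
    exact h hk hk'

/-! ### The blocked-annulus events of the effective configuration -/

/-- `block[n]` is measurable. [folklore] -/
theorem measurableSet_block (n : ℕ) : MeasurableSet (block[n]) :=
  (measurableSet_annulusBlocked n).preimage (measurable_set_iff.2 fun e => by
    simp only [mem_effConfig]
    refine Measurable.or (measurable_set_mem _) ?_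
    refine Measurable.exists fun k => Measurable.and measurable_const ?_
    exact (measurable_set_mem _).and (measurable_set_mem _))

/-- `block[n]` (`n ≥ 1`) is determined by the edges over the annulus `{n ≤ ‖z‖_∞ ≤ 3n}`. [folklore] -/
theorem determinedBy_block {n : ℕ} (hn : 1 ≤ n) :
    DeterminedBy (block[n]) liftPairs[(↑((annulus 2 (n - 1) (3 * n)).sym2) : Set (Sym2 (Site 2)))] :=
  determinedBy_preimage_effConfig (determinedBy_annulusBlocked hn)

/-- Its complement likewise. [folklore] -/
theorem determinedBy_compl_block {n : ℕ} (hn : 1 ≤ n) :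
    DeterminedBy (block[n])ᶜ liftPairs[(↑((annulus 2 (n - 1) (3 * n)).sym2) : Set (Sym2 (Site 2)))] := by
  have h := determinedBy_block hn
  rw [determinedBy_iff] at h ⊢
  intro ω ω' hω
  rw [Set.mem_compl_iff, Set.mem_compl_iff, h ω ω' hω]

/-- The events `(block[4^(k+1)])ᶜ`, `k < K`, are jointly determined by the edges over the box `B(3·4^K)`. [folklore] -/
theorem determinedBy_iInter_compl_block (K : ℕ) :
    DeterminedBy (⋂ k ∈ Finset.range K, (block[4 ^ (k + 1)])ᶜ)
      liftPairs[(↑((box 2 (3 * 4 ^ K)).sym2) : Set (Sym2 (Site 2)))] := by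
  induction K with
  | zero =>
    simp only [Finset.range_zero, Finset.notMem_empty, Set.iInter_of_empty, Set.iInter_univ]
    exact (determinedBy_iff _ _).2 fun _ _ _ => by simp
  | succ K ih =>
    rw [Finset.range_add_one, Finset.set_biInter_insert]
    refine DeterminedBy.inter (DeterminedBy.mono (determinedBy_compl_block (Nat.one_le_pow _ _ (by norm_num))) ?_)
      (ih.mono ?_)
    · -- annulus pairs at scale `4^(K+1)` lie over the box `B(3·4^(K+1))`
      rintro E (⟨e, he, rfl⟩ | ⟨k, hk, hE⟩)
      · refine Or.inl ⟨e, ?_, rfl⟩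
        exact Finset.coe_subset.2 (Finset.sym2_mono Finset.sdiff_subset) he
      · exact Or.inr ⟨k, Finset.coe_subset.2 (Finset.sym2_mono Finset.sdiff_subset) hk, hE⟩
    · have hsub : (↑((box 2 (3 * 4 ^ K)).sym2) : Set (Sym2 (Site 2))) ⊆ ↑((box 2 (3 * 4 ^ (K + 1))).sym2) :=
        Finset.coe_subset.2 (Finset.sym2_mono (box_mono 2 (by
          rw [pow_succ]; have := Nat.one_le_pow K 4 (by norm_num); omega)))
      rintro E (⟨e, he, rfl⟩ | ⟨k, hk, hE⟩)
      · exact Or.inl ⟨e, hsub he, rfl⟩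
      · exact Or.inr ⟨k, hsub hk, hE⟩

/-- Measurability of the finite intersections. [folklore] -/
theorem measurableSet_iInter_compl_block (K : ℕ) :
    MeasurableSet (⋂ k ∈ Finset.range K, (block[4 ^ (k + 1)])ᶜ) :=
  Finset.measurableSet_biInter _ fun _ _ => (measurableSet_block _).compl

/-- **Independence of the scales** (product formula): for every `p` and `K`,
`P_p(⋂_{k<K} {effConfig ∉ annulusBlocked 4^{k+1}}) = ∏_{k<K} (1 − P_p(effConfig ∈ annulusBlocked 4^{k+1}))`.
[cite: BollobasRiordan2006, Ch. 3, proof of Thm. 6] -/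
theorem real_iInter_compl_block (p : unitInterval) (K : ℕ) :
    (μ[p]).real (⋂ k ∈ Finset.range K, (block[4 ^ (k + 1)])ᶜ) =
      ∏ k ∈ Finset.range K, (1 - (μ[p]).real (block[4 ^ (k + 1)])) := by
  induction K with
  | zero => simp
  | succ K ih =>
    rw [Finset.prod_range_succ, Finset.range_add_one, Finset.set_biInter_insert, ← ih,
      ← probReal_compl_eq_one_sub (measurableSet_block _), Set.inter_comm]
    have hlt : 3 * 4 ^ K < 4 ^ (K + 1) := by
      rw [pow_succ]; have := Nat.one_le_pow K 4 (by norm_num); omega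
    exact bondPercolation_real_inter_of_disjoint rayGraph p
      (disjoint_liftPairs (disjoint_sym2_box_sym2_annulus hlt))
      (determinedBy_iInter_compl_block K)
      (determinedBy_compl_block (Nat.one_le_pow _ _ (by norm_num)))
      (measurableSet_iInter_compl_block K) ((measurableSet_block _).compl)

/-! ### The assembly -/

/-- A percolating configuration of `G_ray` (a.e. a genuine one) has no blocked annulus of its effective configuration.
[folklore] -/
theorem percolatesAt_subset_compl_block {ω : BondConfig (Site 2 ⊕ ℕ)} (hω : ω ⊆ rayGraph.edgeSet)
    (h : ω ∈ percolatesAt (Sum.inl (0 : Site 2))) {n : ℕ} (hn : 1 ≤ n) : ω ∉ block[n] := by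
  intro hB
  exact not_mem_percolatesAt_of_annulusBlocked (effConfig_subset_edgeSet hω) hn hB
    (infinite_effCluster_of_percolatesAt hω h)

/-- **The multi-scale assembly.** If for some `c, A, B > 0` and all `k ≥ k₀`,
`c / (A + k B) ≤ P_p(effConfig ω ∈ annulusBlocked 4^{k+1})`, then `θ_{G_ray}(inl 0, p) = 0`.
[cite: BollobasRiordan2006, Ch. 3, Thm. 6] [cite: Zhang1994, Thm. 1 (the line version)] -/
theorem theta_rayGraph_eq_zero_of_blockLower (p : unitInterval) {c A B : ℝ} (hc : 0 < c) (hA : 0 < A) (hB : 0 < B)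
    {k₀ : ℕ} (hlow : ∀ k : ℕ, k₀ ≤ k → c / (A + k * B) ≤ (μ[p]).real (block[4 ^ (k + 1)])) :
    theta rayGraph (Sum.inl (0 : Site 2)) p = 0 := by
  -- shift the hypothesis to all `k` by enlarging `A`
  have hlow' : ∀ k : ℕ, c / ((A + k₀ * B) + k * B) ≤ (μ[p]).real (block[4 ^ (k₀ + k + 1)]) := by
    intro k
    have h := hlow (k₀ + k) (by omega)
    have : A + ((k₀ + k : ℕ) : ℝ) * B = (A + k₀ * B) + k * B := by push_cast; ring
    rwa [this] at h
  have hA' : 0 < A + k₀ * B := by positivity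
  -- θ ≤ P(no block at the scales k₀ ≤ · < k₀ + K) ≤ exp(-partial sum)
  have hbound : ∀ K : ℕ, theta rayGraph (Sum.inl (0 : Site 2)) p ≤
      Real.exp (-∑ k ∈ Finset.range K, c / ((A + k₀ * B) + k * B)) := by
    intro K
    have h1 : theta rayGraph (Sum.inl (0 : Site 2)) p ≤
        (μ[p]).real (⋂ k ∈ Finset.range (k₀ + K), (block[4 ^ (k + 1)])ᶜ) := by
      unfold theta
      refine ENNReal.toReal_mono (measure_ne_top _ _) (measure_mono_ae ?_)
      filter_upwards [ae_subset_edgeSet rayGraph p] with ω hω hperc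
      change ω ∈ ⋂ k ∈ Finset.range (k₀ + K), (block[4 ^ (k + 1)])ᶜ
      simp only [Set.mem_iInter, Set.mem_compl_iff, Finset.mem_range]
      intro k _
      exact percolatesAt_subset_compl_block hω hperc (Nat.one_le_pow _ _ (by norm_num))
    rw [real_iInter_compl_block, Finset.prod_range_add] at h1
    -- drop the first `k₀` factors (each ≤ 1) and bound the rest
    have hle1 : ∏ k ∈ Finset.range k₀, (1 - (μ[p]).real (block[4 ^ (k + 1)])) ≤ 1 :=
      Finset.prod_le_one (fun k _ => sub_nonneg.2 measureReal_le_one)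
        (fun k _ => sub_le_self _ measureReal_nonneg)
    have hnn : 0 ≤ ∏ k ∈ Finset.range K, (1 - (μ[p]).real (block[4 ^ (k₀ + k + 1)])) :=
      Finset.prod_nonneg fun k _ => sub_nonneg.2 measureReal_le_one
    have h2 : (∏ k ∈ Finset.range k₀, (1 - (μ[p]).real (block[4 ^ (k + 1)]))) *
          ∏ k ∈ Finset.range K, (1 - (μ[p]).real (block[4 ^ (k₀ + k + 1)])) ≤
        ∏ k ∈ Finset.range K, (1 - (μ[p]).real (block[4 ^ (k₀ + k + 1)])) := by
      have := mul_le_mul_of_nonneg_right hle1 hnn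
      rwa [one_mul] at this
    have h3 : ∏ k ∈ Finset.range K, (1 - (μ[p]).real (block[4 ^ (k₀ + k + 1)])) ≤
        ∏ k ∈ Finset.range K, (1 - c / ((A + k₀ * B) + k * B)) :=
      Finset.prod_le_prod (fun k _ => sub_nonneg.2 measureReal_le_one) fun k _ => by linarith [hlow' k]
    have h4 : ∏ k ∈ Finset.range K, (1 - c / ((A + k₀ * B) + k * B)) ≤
        Real.exp (-∑ k ∈ Finset.range K, c / ((A + k₀ * B) + k * B)) := by
      -- `∏ (1 - a_k) ≤ exp (-Σ a_k)` for `a_k ≤ 1`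
      rw [← Finset.sum_neg_distrib, Real.exp_sum]
      exact Finset.prod_le_prod (fun k _ => sub_nonneg.2 ((hlow' k).trans measureReal_le_one))
        fun k _ => Real.one_sub_le_exp_neg _
    exact h1.trans (h2.trans (h3.trans h4))
  have hlim : Tendsto (fun K : ℕ => Real.exp (-∑ k ∈ Finset.range K, c / ((A + k₀ * B) + k * B)))
      atTop (𝓝 0) := by
    have hdiv := tendsto_sum_div_affine_atTop hc hA' hB
    exact Real.tendsto_exp_atBot.comp (tendsto_neg_atTop_atBot.comp hdiv)
  exact le_antisymm (ge_of_tendsto' hlim hbound) measureReal_nonneg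

end Ray

end Summit.CriticalPhenomena.PercolationContinuityZ3.Theorems.TransplantSharpness
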